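import Summits.FinalStateConjecture.FinalStateConjecture.Theses.ZeroEnergyKerrOrBomb
import Summits.FinalStateConjecture.FinalStateConjecture.Theorems.ZeroEnergyKerrOrBombHawkingExtensionIsKerrSplit
import Summits.FinalStateConjecture.FinalStateConjecture.Theorems.ZeroEnergyKerrOrBombHawkingExtensionIsKerrSECSection
import Summits.FinalStateConjecture.FinalStateConjecture.Theorems.ZeroEnergyKerrOrBombHawkingExtensionIsKerrNHNoCollarWeak
import Literature.Geometry.Lorentzian.DocStructureTimeFunction
import Literature.Geometry.Lorentzian.CrossSectionSphere
import Literature.AlgebraicTopology.SingularHomology.RelFundamentalClassModTwo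
import Literature.AlgebraicTopology.SingularHomology.WuClassesBoundary
import Literature.AlgebraicTopology.SingularHomology.SimplyConnectedH1
import Literature.AlgebraicTopology.SingularHomology.EulerCharacteristicTriple
import Mathlib.Topology.Homotopy.Equiv
import HarnessLib

/-!
# Crux `HawkingExtensionIsKerr` (stmt-FinalStateConjecture-17840) — line `SketchIdeator2`, lead skeleton r13 (c8, programme TOP)

r13 (continuation lead c8, prover-line-stmt-FinalStateConjecture-17840-c8-0): programme "TOP" — PROVE the
horizon-topology half of child A.  r12b (c7) was closed modulo `stub_facts` = four uniqueness facts ∧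
`chruscielWald1994_crossSectionSphere` (components of the `C⁰` cross-section `∂S̄` are `≃ₜ S²`; a faithful
proof needs 3-manifold duality AND the classification of surfaces).  r13 replaces that fifth conjunct by the
ALREADY ACCEPTED, purely Lorentzian named fact `chruscielCosta2008_equivariantTimeFunction` (CC08 Thm 4.5,
time-function part: a `T`-equivariant function continuous on `doc ∪ 𝓔⁺`) and proves everything else:

* `stub_top_topology` — PURE TOPOLOGY over the tree's mod-2 Lefschetz package: (1) for a compact `C⁰`
  3-manifold with boundary `W` and a clopen `B₀ ⊆ ∂W` all of whose mod-2 1-classes die in `W`, `H₁(Σ; 𝔽₂) = 0`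
  (`RelFundamentalClassModTwo` + the duality ladder `map_range_cohomologyMap_eq_range_δ` + `⟨i*a, [∂W]₂⟩ = 0`:
  the image of `H¹(W)` is cup-isotropic, and mod-2 Poincaré duality of the closed surface `Σ`); (2) a compact
  connected `C⁰` surface with `H₁(·; 𝔽₂) = 0` has finite homology and Euler characteristic `2`;
* `stub_top_flowOut` — the `C⁰` cross-section `∂S̄` is compact and a RETRACT of `𝓔⁺` along the `K`-generators
  (flow-out coordinates + invariance of domain), hence connected;
* `stub_top_closure` — `doc ∪ 𝓔⁺` is simply connected when `doc` is (future-presented: `doc ∪ 𝓔⁺ = cl doc`;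
  loops are pushed off the horizon by a compactly supported past-timelike flow);
* `stub_top_secGen` — c7's SEC construction with "`≃ₜ S²`" weakened to "compact with a `C⁰` 2-atlas";
* `stub_top_slice` — Wald's averaging trick (CC08 Prop 4.6) on the equivariant `t`: a smooth `T`-slice of
  `doc ∪ 𝓔⁺` with boundary `Σ_T ⊆ 𝓔⁺`, retract of `doc ∪ 𝓔⁺` (so simply connected), truncated by a regular
  `T`-invariant sublevel to a compact `C⁰` 3-manifold with boundary `W'` in which every class of `H₁(Σ_T; 𝔽₂)`
  dies (compact supports); `Σ_T ≃ 𝓔⁺` (deformation retraction along `T`-orbits);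
* `stub_top_assembly` — child A'' (= child A of the strategist split + the crux's future-presentation
  hypothesis) from the five bricks, the accepted fact and `noCollar_of_immersedSurface` (p163571).

Composition: `hawkingExtensionIsKerr_of_subs''` (the strategist glue with A'' in place of A, same proof) at
`stub_top_assembly …` and `nondegenerateHawkingExtensionIsKerr_of_four_facts` (…Split.lean).
-/

noncomputable section

set_option linter.dupNamespace false

namespace Summit.FinalStateConjecture.FinalStateConjecture.Theorems.HawkingExtensionIsKerr.SketchIdeator2

open Set Filter Bundle Function Literature.Geometry.Lorentzian Literature.AlgebraicTopology.SingularHomology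
open scoped Manifold ContDiff Topology

/-! ## The residual named-fact debts (four accepted uniqueness facts + CC08 Thm 4.5's time function) -/

/-- **The named-fact debts, conjoined (r13)**: Sudarsky–Wald 1993 staticity, Chruściel–Galloway 2010 static uniqueness, Chruściel 1997 Thm 1.1 (d.o.c.), Chruściel–Costa–Heusler 2012 Thm 3.2 (d.o.c.) and Chruściel–Costa 2008 Thm 4.5 (equivariant time function, `DocStructureTimeFunction.lean`) — each an ACCEPTED Literature `def … : Prop` without `_holds`; none is prover-sized. -/
theorem stub_facts5 : SudarskyWald1993_staticity ∧ ChruscielGalloway2010_docStaticUniqueness ∧ Chrusciel1997_docAxisymmetricCombination ∧ ChruscielCostaHeusler2012_docAxisymmetricUniqueness ∧ chruscielCosta2008_equivariantTimeFunction := by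
  sorry

/-! ## Programme TOP — registered stubs -/

/-- **TOP-A (pure topology).** (1) Mod-2 isotropy: for a compact `C⁰` 3-manifold with boundary `W` and a clopen `B₀ ⊆ ∂W` such that `H₁(Σ; 𝔽₂) → H₁(W; 𝔽₂)` vanishes, `H₁(Σ; 𝔽₂) = 0`.  (2) A compact connected `C⁰` surface with `H₁(·; 𝔽₂) = 0` has finite integral homology concentrated in degrees `< 3` and Euler characteristic `2`. -/
theorem stub_top_topology : (∀ (W : Type) [TopologicalSpace W] [T2Space W] [CompactSpace W] [ChartedSpace (EuclideanHalfSpace 3) W] (B₀ : Set ↥((𝓡∂ 3).boundary W)), IsClopen B₀ → singularHomology.map (ZMod 2) (ZMod 2) (⟨fun x : ↥B₀ ↦ ((x : ↥((𝓡∂ 3).boundary W)) : W), by fun_prop⟩ : C(↥B₀, W)) 1 = 0 → CategoryTheory.Limits.IsZero (singularHomology (ZMod 2) (ZMod 2) ↥B₀ 1)) ∧ (∀ (S : Type) [TopologicalSpace S] [T2Space S] [CompactSpace S] [ConnectedSpace S] [ChartedSpace (EuclideanSpace ℝ (Fin 2)) S], CategoryTheory.Limits.IsZero (singularHomology (ZMod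 2) (ZMod 2) S 1) → FinRelHomology ℤ ℤ S ∅ 3 ∧ relEuler ℤ ℤ S ∅ = 2) := by
  sorry

/-- **TOP-B (flow-out).** In the child-A context (Killing `K` on `U ⊇ 𝓔⁺`, null, nowhere zero, degenerate, time-oriented, locally tangent, with the HR defining functions) the `C⁰` cross-section `∂S̄ = cl S ∖ S` of an `I⁺`-regular hypersurface is compact, a retract of `𝓔⁺` (along the generators = `K`-lines), hence connected when `𝓔⁺` is. -/
theorem stub_top_flowOut : ∀ (𝓑 : StationaryAFBlackHole.{0}) [𝓑.metric.HasLeviCivita] (U : Set 𝓑.carrier) (K : Π x : 𝓑.carrier, TangentSpace (𝓡 4) x), IsOpen U → 𝓑.horizon ⊆ U → 𝓑.metric.toPseudoRiemannianMetric.IsKillingFieldOn K U → (∀ p ∈ 𝓑.horizon, K p ≠ 0) → (∀ p ∈ 𝓑.horizon, 𝓑.metric.val p (K p) (K p) = 0) → ((∀ p ∈ 𝓑.horizon, 𝓑.metric.val p (𝓑.timeOrientation.vectorField p) (K p) < 0) ∨ (∀ p ∈ 𝓑.horizon, 0 < 𝓑.metric.val p (𝓑.timeOrientation.vectorField p) (K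 p))) → (∀ p ∈ 𝓑.horizon, 𝓑.metric.leviCivita K p (K p) = 0) → (∀ p ∈ 𝓑.horizon, ∃ ε > (0 : ℝ), ∃ γ : ℝ → 𝓑.carrier, γ 0 = p ∧ IsMIntegralCurveOn γ K (Ioo (-ε) ε) ∧ ∀ t ∈ Ioo (-ε) ε, γ t ∈ 𝓑.horizon) → (∀ p ∈ 𝓑.horizon, ∃ W : Set 𝓑.carrier, IsOpen W ∧ p ∈ W ∧ W ⊆ U ∧ ∃ F : 𝓑.carrier → ℝ, ContMDiffOn (𝓡 4) 𝓘(ℝ, ℝ) ∞ F W ∧ (∀ x ∈ W, x ∈ 𝓑.horizon ↔ F x = 0) ∧ (∀ x ∈ W, x ∈ 𝓑.doc ↔ F x < 0) ∧ ∀ x ∈ W ∩ 𝓑.horizon, ∃ c : ℝ, c ≠ 0 ∧ ∀ w : TangentSpace (𝓡 4) x, mfderiv (𝓡 4) 𝓘(ℝ, ℝ) F x w = c * 𝓑.metric.val x (K x) w) → ∀ (𝒮 : 𝓑.IPlusRegularHypersurface), IsCompact (closure (Set.range 𝒮.f) \ Set.range 𝒮.f) ∧ (∃ r : C(↥𝓑.horizon,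 ↥(closure (Set.range 𝒮.f) \ Set.range 𝒮.f)), ∀ x : ↥𝓑.horizon, (x : 𝓑.carrier) ∈ closure (Set.range 𝒮.f) \ Set.range 𝒮.f → ((r x : ↥(closure (Set.range 𝒮.f) \ Set.range 𝒮.f)) : 𝓑.carrier) = x) ∧ (IsConnected 𝓑.horizon → IsConnected (closure (Set.range 𝒮.f) \ Set.range 𝒮.f)) := by
  sorry

/-- **TOP-D (closure).** For a future-presented stationary black hole, `doc ∪ 𝓔⁺ = cl doc` is simply connected when `doc` is (loops pushed into `doc` by a compactly supported past-timelike flow). -/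
theorem stub_top_closure : ∀ (𝓑 : StationaryAFBlackHole.{0}) [𝓑.metric.HasLeviCivita], (∀ p : 𝓑.carrier, p ∈ 𝓑.metric.chronologicalFuture 𝓑.timeOrientation 𝓑.Mext) → SimplyConnectedSpace ↥𝓑.doc → SimplyConnectedSpace ↥(𝓑.doc ∪ 𝓑.horizon) := by
  sorry

/-- **TOP-C (SEC, generalised).** c7's `sec_immersedSphere` with the hypothesis `↥C ≃ₜ S²` weakened to: `C` compact and carrying SOME `C⁰` atlas modelled on `ℝ²` (used only for invariance of domain). -/
theorem stub_top_secGen : ∀ (𝓑 : StationaryAFBlackHole.{0}) [𝓑.metric.HasLeviCivita] (U : Set 𝓑.carrier) (K : Π x : 𝓑.carrier, TangentSpace (𝓡 4) x), IsOpen U → 𝓑.horizon ⊆ U → 𝓑.metric.toPseudoRiemannianMetric.IsKillingFieldOn K U → (∀ p ∈ 𝓑.horizon, K p ≠ 0) → (∀ p ∈ 𝓑.horizon, 𝓑.metric.val p (K p) (K p) = 0) → ((∀ p ∈ 𝓑.horizon, 𝓑.metric.val p (𝓑.timeOrientation.vectorField p) (K p) < 0) ∨ (∀ p ∈ 𝓑.horizon,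 0 < 𝓑.metric.val p (𝓑.timeOrientation.vectorField p) (K p))) → (∀ p ∈ 𝓑.horizon, 𝓑.metric.leviCivita K p (K p) = 0) → (∀ p ∈ 𝓑.horizon, ∃ ε > (0 : ℝ), ∃ γ : ℝ → 𝓑.carrier, γ 0 = p ∧ IsMIntegralCurveOn γ K (Ioo (-ε) ε) ∧ ∀ t ∈ Ioo (-ε) ε, γ t ∈ 𝓑.horizon) → (∀ p ∈ 𝓑.horizon, ∃ W : Set 𝓑.carrier, IsOpen W ∧ p ∈ W ∧ W ⊆ U ∧ ∃ F : 𝓑.carrier → ℝ, ContMDiffOn (𝓡 4) 𝓘(ℝ, ℝ) ∞ F W ∧ (∀ x ∈ W, x ∈ 𝓑.horizon ↔ F x = 0) ∧ (∀ x ∈ W, x ∈ 𝓑.doc ↔ F x < 0) ∧ ∀ x ∈ W ∩ 𝓑.horizon, ∃ c : ℝ, c ≠ 0 ∧ ∀ w : TangentSpace (𝓡 4) x, mfderiv (𝓡 4) 𝓘(ℝ, ℝ) F x w = c * 𝓑.metric.val x (K x) w) → ∀ (C : Set 𝓑.carrier), C ⊆ 𝓑.horizon → (∃ C' : Set 𝓑.carrier,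 𝓑.toSpacetime.IsCrossSectionOf 𝓑.horizon C' ∧ C ⊆ C') → IsCompact C → Nonempty (ChartedSpace (EuclideanSpace ℝ (Fin 2)) ↥C) → ∃ (T : Type) (_ : TopologicalSpace T) (_ : ChartedSpace (EuclideanSpace ℝ (Fin 2)) T) (_ : IsManifold (𝓡 2) ∞ T) (_ : T ≃ₜ ↥C) (ι : T → 𝓑.carrier), 𝓑.metric.toPseudoRiemannianMetric.IsSpacelikeImmersion (𝓡 2) ι ∧ Set.range ι ⊆ 𝓑.horizon := by
  sorry

/-- **TOP-E/F (the slice).** From a `T`-equivariant function continuous on `doc ∪ 𝓔⁺` (CC08 Thm 4.5): a compact `C⁰` 3-manifold with boundary `W` and a clopen `B₀ ⊆ ∂W`, homotopy equivalent to `𝓔⁺`, all of whose mod-2 1-classes die in `W` (Wald's averaging trick, half-space charts from `(G, F_HR)` and `(G, Ψ)`, `T`-invariant regular truncation, compact supports). -/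
theorem stub_top_slice : ∀ (𝓑 : StationaryAFBlackHole.{0}) [𝓑.metric.HasLeviCivita] (U : Set 𝓑.carrier) (K : Π x : 𝓑.carrier, TangentSpace (𝓡 4) x), IsOpen U → 𝓑.horizon ⊆ U → (∀ p : 𝓑.carrier, p ∈ 𝓑.metric.chronologicalFuture 𝓑.timeOrientation 𝓑.Mext) → SimplyConnectedSpace ↥(𝓑.doc ∪ 𝓑.horizon) → IsConnected 𝓑.horizon → (∃ B : Set 𝓑.carrier, B ⊆ 𝓑.horizon ∧ IsCompact B ∧ Nonempty (ChartedSpace (EuclideanSpace ℝ (Fin 2)) ↥B) ∧ ∃ r : C(↥𝓑.horizon, ↥B), ∀ x : ↥𝓑.horizon, (x : 𝓑.carrier) ∈ B → ((r x : ↥B) : 𝓑.carrier) = x) → (∀ p ∈ 𝓑.horizon, K p ≠ 0) → (∀ p ∈ 𝓑.horizon, 𝓑.metric.val p (K p) (K p) = 0) → (∀ p ∈ 𝓑.horizon, ∃ W : Set 𝓑.carrier, IsOpen W ∧ p ∈ W ∧ W ⊆ U ∧ ∃ F : 𝓑.carrier → ℝ, ContMDiffOn (𝓡 4) 𝓘(ℝ,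 ℝ) ∞ F W ∧ (∀ x ∈ W, x ∈ 𝓑.horizon ↔ F x = 0) ∧ (∀ x ∈ W, x ∈ 𝓑.doc ↔ F x < 0) ∧ ∀ x ∈ W ∩ 𝓑.horizon, ∃ c : ℝ, c ≠ 0 ∧ ∀ w : TangentSpace (𝓡 4) x, mfderiv (𝓡 4) 𝓘(ℝ, ℝ) F x w = c * 𝓑.metric.val x (K x) w) → ∀ (t : 𝓑.carrier → ℝ), ContinuousOn t (𝓑.doc ∪ 𝓑.horizon) → (∀ γ : ℝ → 𝓑.carrier, IsMIntegralCurve γ 𝓑.killing → γ 0 ∈ 𝓑.doc ∪ 𝓑.horizon → ∀ s : ℝ, t (γ s) = t (γ 0) + s) → ∃ (W : Type) (_ : TopologicalSpace W) (_ : T2Space W) (_ : CompactSpace W) (_ : ChartedSpace (EuclideanHalfSpace 3) W) (B₀ : Set ↥((𝓡∂ 3).boundary W)), IsClopen B₀ ∧ singularHomology.map (ZMod 2) (ZMod 2) (⟨fun x : ↥B₀ ↦ ((x : ↥((𝓡∂ 3).boundary W)) : W), by fun_prop⟩ : C(↥B₀, W)) 1 = 0 ∧ Nonempty (ContinuousMap.HomotopyEquiv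 ↥B₀ ↥𝓑.horizon) := by
  sorry

/-- **TOP-G (assembly).** Child A'' (child A of the split + future-presentation) from TOP-A … TOP-F, the accepted fact `chruscielCosta2008_equivariantTimeFunction` and the NH engine `noCollar_of_immersedSurface` (p163571). -/
theorem stub_top_assembly : ((∀ (W : Type) [TopologicalSpace W] [T2Space W] [CompactSpace W] [ChartedSpace (EuclideanHalfSpace 3) W] (B₀ : Set ↥((𝓡∂ 3).boundary W)), IsClopen B₀ → singularHomology.map (ZMod 2) (ZMod 2) (⟨fun x : ↥B₀ ↦ ((x : ↥((𝓡∂ 3).boundary W)) : W), by fun_prop⟩ : C(↥B₀, W)) 1 = 0 → CategoryTheory.Limits.IsZero (singularHomology (ZMod 2) (ZMod 2) ↥B₀ 1)) ∧ (∀ (S : Type) [TopologicalSpace S] [T2Space S] [CompactSpace S] [ConnectedSpace S] [ChartedSpace (EuclideanSpace ℝ (Fin 2)) S], CategoryTheory.Limits.IsZero (singularHomology (ZMod 2) (ZMod 2) S 1) → FinRelHomology ℤ ℤ S ∅ 3 ∧ relEuler ℤ ℤ S ∅ = 2)) → (∀ (𝓑 : StationaryAFBlackHole.{0}) [𝓑.metric.HasLeviCivita]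 (U : Set 𝓑.carrier) (K : Π x : 𝓑.carrier, TangentSpace (𝓡 4) x), IsOpen U → 𝓑.horizon ⊆ U → 𝓑.metric.toPseudoRiemannianMetric.IsKillingFieldOn K U → (∀ p ∈ 𝓑.horizon, K p ≠ 0) → (∀ p ∈ 𝓑.horizon, 𝓑.metric.val p (K p) (K p) = 0) → ((∀ p ∈ 𝓑.horizon, 𝓑.metric.val p (𝓑.timeOrientation.vectorField p) (K p) < 0) ∨ (∀ p ∈ 𝓑.horizon, 0 < 𝓑.metric.val p (𝓑.timeOrientation.vectorField p) (K p))) → (∀ p ∈ 𝓑.horizon, 𝓑.metric.leviCivita K p (K p) = 0) → (∀ p ∈ 𝓑.horizon, ∃ ε > (0 : ℝ), ∃ γ : ℝ → 𝓑.carrier, γ 0 = p ∧ IsMIntegralCurveOn γ K (Ioo (-ε) ε) ∧ ∀ t ∈ Ioo (-ε) ε, γ t ∈ 𝓑.horizon) → (∀ p ∈ 𝓑.horizon, ∃ W : Set 𝓑.carrier, IsOpen W ∧ p ∈ W ∧ W ⊆ U ∧ ∃ F : 𝓑.carrier → ℝ, ContMDiffOn (𝓡 4) 𝓘(ℝ,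 ℝ) ∞ F W ∧ (∀ x ∈ W, x ∈ 𝓑.horizon ↔ F x = 0) ∧ (∀ x ∈ W, x ∈ 𝓑.doc ↔ F x < 0) ∧ ∀ x ∈ W ∩ 𝓑.horizon, ∃ c : ℝ, c ≠ 0 ∧ ∀ w : TangentSpace (𝓡 4) x, mfderiv (𝓡 4) 𝓘(ℝ, ℝ) F x w = c * 𝓑.metric.val x (K x) w) → ∀ (𝒮 : 𝓑.IPlusRegularHypersurface), IsCompact (closure (Set.range 𝒮.f) \ Set.range 𝒮.f) ∧ (∃ r : C(↥𝓑.horizon, ↥(closure (Set.range 𝒮.f) \ Set.range 𝒮.f)), ∀ x : ↥𝓑.horizon, (x : 𝓑.carrier) ∈ closure (Set.range 𝒮.f) \ Set.range 𝒮.f → ((r x : ↥(closure (Set.range 𝒮.f) \ Set.range 𝒮.f)) : 𝓑.carrier) = x) ∧ (IsConnected 𝓑.horizon → IsConnected (closure (Set.range 𝒮.f) \ Set.range 𝒮.f))) → (∀ (𝓑 : StationaryAFBlackHole.{0}) [𝓑.metric.HasLeviCivita], (∀ p : 𝓑.carrier, p ∈ 𝓑.metric.chronologicalFuture 𝓑.timeOrientation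 𝓑.Mext) → SimplyConnectedSpace ↥𝓑.doc → SimplyConnectedSpace ↥(𝓑.doc ∪ 𝓑.horizon)) → (∀ (𝓑 : StationaryAFBlackHole.{0}) [𝓑.metric.HasLeviCivita] (U : Set 𝓑.carrier) (K : Π x : 𝓑.carrier, TangentSpace (𝓡 4) x), IsOpen U → 𝓑.horizon ⊆ U → 𝓑.metric.toPseudoRiemannianMetric.IsKillingFieldOn K U → (∀ p ∈ 𝓑.horizon, K p ≠ 0) → (∀ p ∈ 𝓑.horizon, 𝓑.metric.val p (K p) (K p) = 0) → ((∀ p ∈ 𝓑.horizon, 𝓑.metric.val p (𝓑.timeOrientation.vectorField p) (K p) < 0) ∨ (∀ p ∈ 𝓑.horizon, 0 < 𝓑.metric.val p (𝓑.timeOrientation.vectorField p) (K p))) → (∀ p ∈ 𝓑.horizon, 𝓑.metric.leviCivita K p (K p) = 0) → (∀ p ∈ 𝓑.horizon, ∃ ε > (0 : ℝ), ∃ γ : ℝ → 𝓑.carrier, γ 0 = p ∧ IsMIntegralCurveOn γ K (Ioo (-ε) ε) ∧ ∀ t ∈ Ioo (-ε) ε, γ t ∈ 𝓑.horizon) → (∀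 p ∈ 𝓑.horizon, ∃ W : Set 𝓑.carrier, IsOpen W ∧ p ∈ W ∧ W ⊆ U ∧ ∃ F : 𝓑.carrier → ℝ, ContMDiffOn (𝓡 4) 𝓘(ℝ, ℝ) ∞ F W ∧ (∀ x ∈ W, x ∈ 𝓑.horizon ↔ F x = 0) ∧ (∀ x ∈ W, x ∈ 𝓑.doc ↔ F x < 0) ∧ ∀ x ∈ W ∩ 𝓑.horizon, ∃ c : ℝ, c ≠ 0 ∧ ∀ w : TangentSpace (𝓡 4) x, mfderiv (𝓡 4) 𝓘(ℝ, ℝ) F x w = c * 𝓑.metric.val x (K x) w) → ∀ (C : Set 𝓑.carrier), C ⊆ 𝓑.horizon → (∃ C' : Set 𝓑.carrier, 𝓑.toSpacetime.IsCrossSectionOf 𝓑.horizon C' ∧ C ⊆ C') → IsCompact C → Nonempty (ChartedSpace (EuclideanSpace ℝ (Fin 2)) ↥C) → ∃ (T : Type) (_ : TopologicalSpace T) (_ : ChartedSpace (EuclideanSpace ℝ (Fin 2)) T) (_ : IsManifold (𝓡 2) ∞ T) (_ : T ≃ₜ ↥C) (ι : T → 𝓑.carrier), 𝓑.metric.toPseudoRiemannianMetric.IsSpacelikeImmersion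 (𝓡 2) ι ∧ Set.range ι ⊆ 𝓑.horizon) → (∀ (𝓑 : StationaryAFBlackHole.{0}) [𝓑.metric.HasLeviCivita] (U : Set 𝓑.carrier) (K : Π x : 𝓑.carrier, TangentSpace (𝓡 4) x), IsOpen U → 𝓑.horizon ⊆ U → (∀ p : 𝓑.carrier, p ∈ 𝓑.metric.chronologicalFuture 𝓑.timeOrientation 𝓑.Mext) → SimplyConnectedSpace ↥(𝓑.doc ∪ 𝓑.horizon) → IsConnected 𝓑.horizon → (∃ B : Set 𝓑.carrier, B ⊆ 𝓑.horizon ∧ IsCompact B ∧ Nonempty (ChartedSpace (EuclideanSpace ℝ (Fin 2)) ↥B) ∧ ∃ r : C(↥𝓑.horizon, ↥B), ∀ x : ↥𝓑.horizon, (x : 𝓑.carrier) ∈ B → ((r x : ↥B) : 𝓑.carrier) = x) → (∀ p ∈ 𝓑.horizon, K p ≠ 0) → (∀ p ∈ 𝓑.horizon, 𝓑.metric.val p (K p) (K p) = 0) → (∀ p ∈ 𝓑.horizon, ∃ W : Set 𝓑.carrier, IsOpen W ∧ p ∈ W ∧ W ⊆ U ∧ ∃ F : 𝓑.carrier → ℝ,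 ContMDiffOn (𝓡 4) 𝓘(ℝ, ℝ) ∞ F W ∧ (∀ x ∈ W, x ∈ 𝓑.horizon ↔ F x = 0) ∧ (∀ x ∈ W, x ∈ 𝓑.doc ↔ F x < 0) ∧ ∀ x ∈ W ∩ 𝓑.horizon, ∃ c : ℝ, c ≠ 0 ∧ ∀ w : TangentSpace (𝓡 4) x, mfderiv (𝓡 4) 𝓘(ℝ, ℝ) F x w = c * 𝓑.metric.val x (K x) w) → ∀ (t : 𝓑.carrier → ℝ), ContinuousOn t (𝓑.doc ∪ 𝓑.horizon) → (∀ γ : ℝ → 𝓑.carrier, IsMIntegralCurve γ 𝓑.killing → γ 0 ∈ 𝓑.doc ∪ 𝓑.horizon → ∀ s : ℝ, t (γ s) = t (γ 0) + s) → ∃ (W : Type) (_ : TopologicalSpace W) (_ : T2Space W) (_ : CompactSpace W) (_ : ChartedSpace (EuclideanHalfSpace 3) W) (B₀ : Set ↥((𝓡∂ 3).boundary W)), IsClopen B₀ ∧ singularHomology.map (ZMod 2) (ZMod 2) (⟨fun x : ↥B₀ ↦ ((x : ↥((𝓡∂ 3).boundary W)) : W), by fun_prop⟩ : C(↥B₀,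 W)) 1 = 0 ∧ Nonempty (ContinuousMap.HomotopyEquiv ↥B₀ ↥𝓑.horizon)) → chruscielCosta2008_equivariantTimeFunction → (∀ (𝓑 : Literature.Geometry.Lorentzian.StationaryAFBlackHole.{0}) [𝓑.metric.HasLeviCivita], 𝓑.metric.toPseudoRiemannianMetric.IsRicciFlat → 𝓑.IsIPlusRegular → (∀ p : 𝓑.carrier, p ∈ 𝓑.metric.chronologicalFuture 𝓑.timeOrientation 𝓑.Mext) → IsConnected 𝓑.horizon → SimplyConnectedSpace 𝓑.doc → ∀ (U : Set 𝓑.carrier) (K : Π x : 𝓑.carrier, TangentSpace (𝓡 4) x), IsOpen U → 𝓑.horizon ⊆ U → Literature.Geometry.Lorentzian.PseudoRiemannianMetric.IsKillingFieldOn 𝓑.metric.toPseudoRiemannianMetric K U → (∀ x ∈ U, VectorField.mlieBracket (𝓡 4) 𝓑.killing K x = 0) → (∀ p ∈ 𝓑.horizon, K p ≠ 0) → (∀ p ∈ 𝓑.horizon, 𝓑.metric.val p (K p) (K p) = 0) → (∀ p ∈ 𝓑.horizon, ∃ ε > (0 : ℝ), ∃ γ : ℝ → 𝓑.carrier, γ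 0 = p ∧ IsMIntegralCurveOn γ K (Set.Ioo (-ε) ε) ∧ ∀ t ∈ Set.Ioo (-ε) ε, γ t ∈ 𝓑.horizon) → (∀ p ∈ 𝓑.horizon, 𝓑.metric.leviCivita K p (K p) = 0) → (∀ p ∈ 𝓑.horizon, ∃ W : Set 𝓑.carrier, IsOpen W ∧ p ∈ W ∧ W ⊆ U ∧ ∃ F : 𝓑.carrier → ℝ, ContMDiffOn (𝓡 4) 𝓘(ℝ, ℝ) ((⊤ : ℕ∞) : WithTop ℕ∞) F W ∧ (∀ x ∈ W, x ∈ 𝓑.horizon ↔ F x = 0) ∧ (∀ x ∈ W, x ∈ 𝓑.doc ↔ F x < 0) ∧ ∀ x ∈ W ∩ 𝓑.horizon, ∃ c : ℝ, c ≠ 0 ∧ ∀ w : TangentSpace (𝓡 4) x, mfderiv (𝓡 4) 𝓘(ℝ, ℝ) F x w = c * 𝓑.metric.val x (K x) w) → ∀ V : Set 𝓑.carrier, IsOpen V → 𝓑.horizon ⊆ V → ∃ x ∈ V ∩ 𝓑.doc, 0 < 𝓑.metric.val x (K x) (K x)) := by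
  sorry

/-! ## The glue with child A'' (strategist glue `hawkingExtensionIsKerr_of_subs`, …Split.lean, with the future-presentation hypothesis passed to A) -/

/-- **The crux body from child A'' and child B** (same proof as `hawkingExtensionIsKerr_of_subs`, …Split.lean p163089; A'' = A + the crux's future-presentation hypothesis). -/
theorem hawkingExtensionIsKerr_of_subs'' : ((∀ (𝓑 : Literature.Geometry.Lorentzian.StationaryAFBlackHole.{0}) [𝓑.metric.HasLeviCivita], 𝓑.metric.toPseudoRiemannianMetric.IsRicciFlat → 𝓑.IsIPlusRegular → (∀ p : 𝓑.carrier, p ∈ 𝓑.metric.chronologicalFuture 𝓑.timeOrientation 𝓑.Mext) → IsConnected 𝓑.horizon → SimplyConnectedSpace 𝓑.doc → ∀ (U : Set 𝓑.carrier) (K : Π x : 𝓑.carrier, TangentSpace (𝓡 4) x), IsOpen U → 𝓑.horizon ⊆ U → Literature.Geometry.Lorentzian.PseudoRiemannianMetric.IsKillingFieldOn 𝓑.metric.toPseudoRiemannianMetric K U → (∀ x ∈ U, VectorField.mlieBracket (𝓡 4) 𝓑.killing K x = 0) → (∀ p ∈ 𝓑.horizon, K p ≠ 0) → (∀ p ∈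 𝓑.horizon, 𝓑.metric.val p (K p) (K p) = 0) → (∀ p ∈ 𝓑.horizon, ∃ ε > (0 : ℝ), ∃ γ : ℝ → 𝓑.carrier, γ 0 = p ∧ IsMIntegralCurveOn γ K (Set.Ioo (-ε) ε) ∧ ∀ t ∈ Set.Ioo (-ε) ε, γ t ∈ 𝓑.horizon) → (∀ p ∈ 𝓑.horizon, 𝓑.metric.leviCivita K p (K p) = 0) → (∀ p ∈ 𝓑.horizon, ∃ W : Set 𝓑.carrier, IsOpen W ∧ p ∈ W ∧ W ⊆ U ∧ ∃ F : 𝓑.carrier → ℝ, ContMDiffOn (𝓡 4) 𝓘(ℝ, ℝ) ((⊤ : ℕ∞) : WithTop ℕ∞) F W ∧ (∀ x ∈ W, x ∈ 𝓑.horizon ↔ F x = 0) ∧ (∀ x ∈ W, x ∈ 𝓑.doc ↔ F x < 0) ∧ ∀ x ∈ W ∩ 𝓑.horizon, ∃ c : ℝ, c ≠ 0 ∧ ∀ w : TangentSpace (𝓡 4) x, mfderiv (𝓡 4) 𝓘(ℝ, ℝ) F x w = c * 𝓑.metric.val x (K x) w) → ∀ V : Set 𝓑.carrier, IsOpen V →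 𝓑.horizon ⊆ V → ∃ x ∈ V ∩ 𝓑.doc, 0 < 𝓑.metric.val x (K x) (K x))) → (∀ (𝓑 : Literature.Geometry.Lorentzian.StationaryAFBlackHole.{0}) [𝓑.metric.HasLeviCivita] [Literature.Geometry.Lorentzian.Kerr.Facts], 𝓑.metric.toPseudoRiemannianMetric.IsRicciFlat → 𝓑.IsIPlusRegular → (∀ p : 𝓑.carrier, p ∈ 𝓑.metric.chronologicalFuture 𝓑.timeOrientation 𝓑.Mext) → (∀ p ∈ 𝓑.doc, 𝓑.killing p ≠ 0) → SimplyConnectedSpace 𝓑.doc → ∀ (U : Set 𝓑.carrier) (K : Π x : 𝓑.carrier, TangentSpace (𝓡 4) x), IsOpen U → 𝓑.horizon ⊆ U → IsConnected 𝓑.horizon → ContMDiffOn (𝓡 4) ((𝓡 4).prod 𝓘(ℝ, Literature.Geometry.Lorentzian.E4)) ((⊤ : ℕ∞) : WithTop ℕ∞) (fun x ↦ (Bundle.TotalSpace.mk' Literature.Geometry.Lorentzian.E4 x (K x) : TangentBundle (𝓡 4) 𝓑.carrier)) U → (∀ x ∈ U, ∀ v w : TangentSpace (𝓡 4) x, 𝓑.metric.val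 x (𝓑.metric.leviCivita K x v) w + 𝓑.metric.val x v (𝓑.metric.leviCivita K x w) = 0) → (∀ x ∈ U, VectorField.mlieBracket (𝓡 4) 𝓑.killing K x = 0) → (∀ p ∈ 𝓑.horizon, K p ≠ 0) → (∀ γ : ℝ → 𝓑.carrier, IsMIntegralCurve γ K → γ 0 ∈ 𝓑.horizon → ∀ t, γ t ∈ 𝓑.horizon) → (∀ x ∈ U ∩ 𝓑.doc, 𝓑.metric.val x (K x) (K x) < 0) → ((∀ p ∈ 𝓑.horizon, 𝓑.metric.val p (K p) (K p) = 0) → (∀ p ∈ 𝓑.horizon, ∃ ε > (0 : ℝ), ∃ γ : ℝ → 𝓑.carrier, γ 0 = p ∧ IsMIntegralCurveOn γ K (Set.Ioo (-ε) ε) ∧ ∀ t ∈ Set.Ioo (-ε) ε, γ t ∈ 𝓑.horizon) → (∀ p ∈ 𝓑.horizon, 𝓑.metric.leviCivita K p (K p) = 0) → ∀ V : Set 𝓑.carrier, IsOpen V → 𝓑.horizon ⊆ V → ∃ x ∈ V ∩ 𝓑.doc, 0 < 𝓑.metric.val x (K x) (K x)) → (∃ K' : Π x : 𝓑.carrier,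 TangentSpace (𝓡 4) x, ContMDiffOn (𝓡 4) ((𝓡 4).prod 𝓘(ℝ, Literature.Geometry.Lorentzian.E4)) ((⊤ : ℕ∞) : WithTop ℕ∞) (fun x ↦ (Bundle.TotalSpace.mk' Literature.Geometry.Lorentzian.E4 x (K' x) : TangentBundle (𝓡 4) 𝓑.carrier)) 𝓑.doc ∧ (∀ x ∈ 𝓑.doc, ∀ v w : TangentSpace (𝓡 4) x, 𝓑.metric.val x (𝓑.metric.leviCivita K' x v) w + 𝓑.metric.val x v (𝓑.metric.leviCivita K' x w) = 0) ∧ (∀ x ∈ 𝓑.doc, VectorField.mlieBracket (𝓡 4) 𝓑.killing K' x = 0) ∧ ∃ U' : Set 𝓑.carrier, IsOpen U' ∧ 𝓑.horizon ⊆ U' ∧ ∀ x ∈ U' ∩ 𝓑.doc, K' x = K x) → ∃ (M a : ℝ), Literature.Geometry.Lorentzian.Kerr.IsSubextremal M a ∧ ∃ Ψ : Literature.Geometry.Lorentzian.Kerr.exterior M a → 𝓑.carrier, Function.Injective Ψ ∧ Set.range Ψ = 𝓑.doc ∧ Literature.Geometry.Lorentzian.PseudoRiemannianMetric.IsIsometricImmersion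 (Literature.Geometry.Lorentzian.Kerr.smoothMetric M a (Literature.Geometry.Lorentzian.Kerr.rPlus M a)).toPseudoRiemannianMetric 𝓑.metric.toPseudoRiemannianMetric Ψ) → ∀ (𝓑 : Literature.Geometry.Lorentzian.StationaryAFBlackHole.{0}) [𝓑.metric.HasLeviCivita] [Literature.Geometry.Lorentzian.Kerr.Facts], 𝓑.metric.toPseudoRiemannianMetric.IsRicciFlat → 𝓑.IsIPlusRegular → (∀ p : 𝓑.carrier, p ∈ 𝓑.metric.chronologicalFuture 𝓑.timeOrientation 𝓑.Mext) → (∀ p ∈ 𝓑.doc, 𝓑.killing p ≠ 0) → SimplyConnectedSpace 𝓑.doc → ∀ (U : Set 𝓑.carrier) (K : Π x : 𝓑.carrier, TangentSpace (𝓡 4) x), IsOpen U → 𝓑.horizon ⊆ U → IsConnected 𝓑.horizon → ContMDiffOn (𝓡 4) ((𝓡 4).prod 𝓘(ℝ, Literature.Geometry.Lorentzian.E4)) ((⊤ : ℕ∞) : WithTop ℕ∞) (fun x ↦ (Bundle.TotalSpace.mk' Literature.Geometry.Lorentzian.E4 x (K x) : TangentBundle (𝓡 4) 𝓑.carrier))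 U → (∀ x ∈ U, ∀ v w : TangentSpace (𝓡 4) x, 𝓑.metric.val x (𝓑.metric.leviCivita K x v) w + 𝓑.metric.val x v (𝓑.metric.leviCivita K x w) = 0) → (∀ x ∈ U, VectorField.mlieBracket (𝓡 4) 𝓑.killing K x = 0) → (∀ p ∈ 𝓑.horizon, K p ≠ 0) → (∀ γ : ℝ → 𝓑.carrier, IsMIntegralCurve γ K → γ 0 ∈ 𝓑.horizon → ∀ t, γ t ∈ 𝓑.horizon) → (∀ x ∈ U ∩ 𝓑.doc, 𝓑.metric.val x (K x) (K x) < 0) → (∃ K' : Π x : 𝓑.carrier, TangentSpace (𝓡 4) x, ContMDiffOn (𝓡 4) ((𝓡 4).prod 𝓘(ℝ, Literature.Geometry.Lorentzian.E4)) ((⊤ : ℕ∞) : WithTop ℕ∞) (fun x ↦ (Bundle.TotalSpace.mk' Literature.Geometry.Lorentzian.E4 x (K' x) : TangentBundle (𝓡 4) 𝓑.carrier)) 𝓑.doc ∧ (∀ x ∈ 𝓑.doc, ∀ v w : TangentSpace (𝓡 4) x, 𝓑.metric.val x (𝓑.metric.leviCivita K' x v) w + 𝓑.metric.val x v (𝓑.metric.leviCivita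 K' x w) = 0) ∧ (∀ x ∈ 𝓑.doc, VectorField.mlieBracket (𝓡 4) 𝓑.killing K' x = 0) ∧ ∃ U' : Set 𝓑.carrier, IsOpen U' ∧ 𝓑.horizon ⊆ U' ∧ ∀ x ∈ U' ∩ 𝓑.doc, K' x = K x) → ∃ (M a : ℝ), Literature.Geometry.Lorentzian.Kerr.IsSubextremal M a ∧ ∃ Ψ : Literature.Geometry.Lorentzian.Kerr.exterior M a → 𝓑.carrier, Function.Injective Ψ ∧ Set.range Ψ = 𝓑.doc ∧ Literature.Geometry.Lorentzian.PseudoRiemannianMetric.IsIsometricImmersion (Literature.Geometry.Lorentzian.Kerr.smoothMetric M a (Literature.Geometry.Lorentzian.Kerr.rPlus M a)).toPseudoRiemannianMetric 𝓑.metric.toPseudoRiemannianMetric Ψ := by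
  intro hA hB 𝓑 _ _ hvac hreg hfut hT hsc U K hU hHU hconn hKs hKk hKc hKne hKtan hKtl hext
  refine hB 𝓑 hvac hreg hfut hT hsc U K hU hHU hconn hKs hKk hKc hKne hKtan hKtl ?_ hext
  intro hnull htan hdeg V hV hHV
  exact hA 𝓑 hvac hreg hfut hconn hsc U K hU hHU ⟨hKs, hKk⟩ hKc hKne hnull htan hdeg
    (stub_hr_assembly 𝓑 U K hU hHU hKs hKne hnull htan) V hV hHV

/-! ## Composition -/

/-- **The crux from the stubs (r13).**  `ZeroEnergyKerrOrBomb.HawkingExtensionIsKerr` (rev 9, by name)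
through the glue at child A'' (programme TOP + CC08 Thm 4.5's time function) and child B (the four classical
uniqueness facts, `nondegenerateHawkingExtensionIsKerr_of_four_facts`, …Split.lean). -/
theorem HawkingExtensionIsKerr_of :
    Summit.FinalStateConjecture.FinalStateConjecture.Theses.ZeroEnergyKerrOrBomb.HawkingExtensionIsKerr :=
  hawkingExtensionIsKerr_of_subs''
    (stub_top_assembly stub_top_topology stub_top_flowOut stub_top_closure stub_top_secGen stub_top_slice
      stub_facts5.2.2.2.2)
    (nondegenerateHawkingExtensionIsKerr_of_four_facts stub_facts5.1 stub_facts5.2.1 stub_facts5.2.2.1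
      stub_facts5.2.2.2.1)

end Summit.FinalStateConjecture.FinalStateConjecture.Theorems.HawkingExtensionIsKerr.SketchIdeator2

end
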